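import Summits.Ventures.Crystal3D.Theorems.StickyWulffConstantNoReconstructionGainBlanketDissolution
import HarnessLib

/-!
# Dissolution glue, II: the pair step `D₂` implies the blanket bound

HONEST FRAMING. Part of the venture `Summits/Ventures/Crystal3D` (cell `crystal3d-full`), helper
`--supports` the crux `NoReconstructionGain` (stmt-Ventures-19144, route
`route-Ventures-StickyWulffConstant`), line `adhesion`; continuation of `…BlanketDissolution`
(set-dissolution glue `blanketBound_of_setDissolution`).  cf-p2's R27 killed the one-ball
dissolution conjecture D (rod22, slack `4 − 3√2`) and proposed the repair
`PairDissolutionStep` (`D₂`): at every unit normal every non-empty unit packing has a ball `t` with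
`4√3 · e_ν(t) ≤ 12 − 2 deg t` OR a pair `s ≠ t` with
`4√3 · e_ν({s,t}) ≤ 24 − 2 deg s − 2 deg t + 2·[dist (x s) (x t) = 1]`
(rod family: best pair slack `+0.88 … +0.98`; not censused beyond it).  Here:

* `exists_labelling` — a non-empty finite point set is the range of an injective `Fin (N+1)`-family
  (with the dictionary degree-in-`X` = `coordination`);
* `blanket_of_pairDissolutionStep` — `D₂ ⇒ BlanketBound` (cf-p1's landed `CellFlux.BlanketBound`),
  def-free, the `#T ≤ 2` instance of the set glue.

WHAT THIS IS NOT: `D₂` is a conjecture (uncensused outside the rod family); the blanket bound stays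
a conjecture; rung F-C1 not moved.
-/

noncomputable section

namespace Summit.Ventures.Crystal3D.Theorems

open Summit.Ventures.Crystal3D Finset MeasureTheory
open Summit.Ventures.Crystal3D.Cruxes.NoReconstructionGain.CellFlux (lateralSq shadowSlab shadowArea
  blanketRadius BlanketBound)
open Literature.MathematicalPhysics.StatisticalMechanics (orderedContacts contactDeficiency)
open scoped InnerProductSpace

/-- **Labelling a finite point set.**  A non-empty `X` is the range of an injective family
`x : Fin (N + 1) → ℝ³`, and the number of points of `X` at distance `1` from `x i` is the
coordination of `i`. -/
theorem exists_labelling (X : Finset (EuclideanSpace ℝ (Fin 3))) (hne : X.Nonempty) :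
    ∃ (N : ℕ) (x : Fin (N + 1) → EuclideanSpace ℝ (Fin 3)), Function.Injective x ∧
      (∀ i, x i ∈ X) ∧ (∀ p ∈ X, ∃ i, x i = p) ∧
      ∀ i, (X.filter fun q => dist (x i) q = 1).card = coordination x i := by
  classical
  obtain ⟨N, hN⟩ : ∃ N, X.card = N + 1 := ⟨X.card - 1, (Nat.succ_pred_eq_of_pos (card_pos.2 hne)).symm⟩
  set e : Fin (N + 1) ≃ X := (Fintype.equivFinOfCardEq (by rw [Fintype.card_coe, hN])).symm with he
  set x : Fin (N + 1) → EuclideanSpace ℝ (Fin 3) := fun i => (e i : EuclideanSpace ℝ (Fin 3)) with hxdef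
  have hxmem : ∀ i, x i ∈ X := fun i => (e i).2
  have hxinj : Function.Injective x := fun i j h => e.injective (Subtype.ext h)
  have hxsurj : ∀ p ∈ X, ∃ i, x i = p := fun p hp => ⟨e.symm ⟨p, hp⟩, by simp [hxdef]⟩
  refine ⟨N, x, hxinj, hxmem, hxsurj, fun i => ?_⟩
  rw [coordination, contactNeighbors]
  have himg : (X.filter fun q => dist (x i) q = 1) =
      ((univ.filter fun j => j ≠ i ∧ dist (x i) (x j) = 1).image x) := by
    ext q
    simp only [mem_filter, mem_image, mem_univ, true_and]
    constructor
    · rintro ⟨hq, hd⟩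
      obtain ⟨j, rfl⟩ := hxsurj q hq
      refine ⟨j, ⟨fun h => ?_, hd⟩, rfl⟩
      rw [h, dist_self] at hd; exact absurd hd (by norm_num)
    · rintro ⟨j, ⟨-, hd⟩, rfl⟩
      exact ⟨hxmem j, hd⟩
  rw [himg, card_image_of_injective _ hxinj]

/-- **`D₂ ⇒ blanket`** (cf-p2 R27's `PairDissolutionStep`, def-free). -/
theorem blanket_of_pairDissolutionStep :
    (∀ (N : ℕ) (x : Fin (N + 1) → EuclideanSpace ℝ (Fin 3)), Summit.Ventures.Crystal3D.IsUnitPacking x →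
      ∀ ν : EuclideanSpace ℝ (Fin 3), ‖ν‖ = 1 →
        (∃ t : Fin (N + 1),
          4 * Real.sqrt 3 * (MeasureTheory.volume {y : EuclideanSpace ℝ (Fin 3) |
              Summit.Ventures.Crystal3D.Cruxes.NoReconstructionGain.CellFlux.lateralSq ν (x t) y ≤
                Summit.Ventures.Crystal3D.Cruxes.NoReconstructionGain.CellFlux.blanketRadius ^ 2 ∧
              (∀ j, j ≠ t → Summit.Ventures.Crystal3D.Cruxes.NoReconstructionGain.CellFlux.blanketRadius ^ 2 <
                Summit.Ventures.Crystal3D.Cruxes.NoReconstructionGain.CellFlux.lateralSq ν (x j) y) ∧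
              |⟪y, ν⟫_ℝ| ≤ 1 / 2}).toReal ≤
            12 - 2 * (Summit.Ventures.Crystal3D.coordination x t : ℝ)) ∨
        (∃ s t : Fin (N + 1), s ≠ t ∧
          4 * Real.sqrt 3 * (MeasureTheory.volume {y : EuclideanSpace ℝ (Fin 3) |
              (Summit.Ventures.Crystal3D.Cruxes.NoReconstructionGain.CellFlux.lateralSq ν (x s) y ≤
                  Summit.Ventures.Crystal3D.Cruxes.NoReconstructionGain.CellFlux.blanketRadius ^ 2 ∨
                Summit.Ventures.Crystal3D.Cruxes.NoReconstructionGain.CellFlux.lateralSq ν (x t) y ≤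
                  Summit.Ventures.Crystal3D.Cruxes.NoReconstructionGain.CellFlux.blanketRadius ^ 2) ∧
              (∀ j, j ≠ s → j ≠ t →
                Summit.Ventures.Crystal3D.Cruxes.NoReconstructionGain.CellFlux.blanketRadius ^ 2 <
                  Summit.Ventures.Crystal3D.Cruxes.NoReconstructionGain.CellFlux.lateralSq ν (x j) y) ∧
              |⟪y, ν⟫_ℝ| ≤ 1 / 2}).toReal ≤
            24 - 2 * (Summit.Ventures.Crystal3D.coordination x s : ℝ) -
              2 * (Summit.Ventures.Crystal3D.coordination x t : ℝ) +
              (if dist (x s) (x t) = 1 then 2 else 0))) →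
    Summit.Ventures.Crystal3D.Cruxes.NoReconstructionGain.CellFlux.BlanketBound := by
  classical
  intro H
  refine blanketBound_of_setDissolution fun ν hν X hX hne => ?_
  obtain ⟨N, x, hxinj, hxmem, hxsurj, hdeg⟩ := exists_labelling X hne
  have hx : IsUnitPacking x := fun i j hij => hX _ (hxmem i) _ (hxmem j) fun h => hij (hxinj h)
  rcases H N x hx ν hν with ⟨t, ht⟩ | ⟨s, t, hst, hst'⟩
  · -- one ball
    refine ⟨{x t}, by simpa using hxmem t, singleton_nonempty _, ?_⟩
    have hset : {y : EuclideanSpace ℝ (Fin 3) | (∃ p ∈ ({x t} : Finset (EuclideanSpace ℝ (Fin 3))),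
          lateralSq ν p y ≤ blanketRadius ^ 2) ∧
        (∀ q ∈ X \ {x t}, blanketRadius ^ 2 < lateralSq ν q y) ∧ |⟪y, ν⟫_ℝ| ≤ 1 / 2} =
        {y | lateralSq ν (x t) y ≤ blanketRadius ^ 2 ∧
          (∀ j, j ≠ t → blanketRadius ^ 2 < lateralSq ν (x j) y) ∧ |⟪y, ν⟫_ℝ| ≤ 1 / 2} := by
      ext y
      simp only [Set.mem_setOf_eq, mem_singleton, exists_eq_left, mem_sdiff]
      constructor
      · rintro ⟨h1, h2, h3⟩
        exact ⟨h1, fun j hj => h2 (x j) ⟨hxmem j, fun h => hj (hxinj h)⟩, h3⟩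
      · rintro ⟨h1, h2, h3⟩
        refine ⟨h1, fun q hq => ?_, h3⟩
        obtain ⟨j, rfl⟩ := hxsurj q hq.1
        exact h2 j fun h => hq.2 (by rw [h])
    have hoc : orderedContacts ({x t} : Finset (EuclideanSpace ℝ (Fin 3))) = 0 := by
      unfold orderedContacts
      rw [card_eq_zero, filter_eq_empty_iff]
      intro p hp
      rw [singleton_product_singleton, mem_singleton] at hp
      rw [hp, dist_self]; norm_num
    rw [hset, sum_singleton, hdeg, hoc]
    push_cast
    linarith
  · -- a pair
    have hxst : x s ≠ x t := fun h => hst (hxinj h)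
    refine ⟨{x s, x t}, ?_, insert_nonempty _ _, ?_⟩
    · intro p hp
      rw [mem_insert, mem_singleton] at hp
      rcases hp with rfl | rfl
      · exact hxmem s
      · exact hxmem t
    have hset : {y : EuclideanSpace ℝ (Fin 3) |
        (∃ p ∈ ({x s, x t} : Finset (EuclideanSpace ℝ (Fin 3))), lateralSq ν p y ≤ blanketRadius ^ 2) ∧
        (∀ q ∈ X \ {x s, x t}, blanketRadius ^ 2 < lateralSq ν q y) ∧ |⟪y, ν⟫_ℝ| ≤ 1 / 2} =
        {y | (lateralSq ν (x s) y ≤ blanketRadius ^ 2 ∨ lateralSq ν (x t) y ≤ blanketRadius ^ 2) ∧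
          (∀ j, j ≠ s → j ≠ t → blanketRadius ^ 2 < lateralSq ν (x j) y) ∧ |⟪y, ν⟫_ℝ| ≤ 1 / 2} := by
      ext y
      simp only [Set.mem_setOf_eq, mem_insert, mem_singleton, mem_sdiff, not_or]
      constructor
      · rintro ⟨⟨p, hp, hL⟩, h2, h3⟩
        refine ⟨?_, fun j hjs hjt => h2 (x j) ⟨hxmem j, fun h => hjs (hxinj h), fun h => hjt (hxinj h)⟩,
          h3⟩
        rcases hp with rfl | rfl
        · exact Or.inl hL
        · exact Or.inr hL
      · rintro ⟨h1, h2, h3⟩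
        refine ⟨?_, fun q hq => ?_, h3⟩
        · rcases h1 with h | h
          · exact ⟨x s, Or.inl rfl, h⟩
          · exact ⟨x t, Or.inr rfl, h⟩
        · obtain ⟨j, rfl⟩ := hxsurj q hq.1
          exact h2 j (fun h => hq.2.1 (by rw [h])) (fun h => hq.2.2 (by rw [h]))
    have hoc : (orderedContacts ({x s, x t} : Finset (EuclideanSpace ℝ (Fin 3))) : ℝ) =
        if dist (x s) (x t) = 1 then 2 else 0 := by
      unfold orderedContacts
      rw [card_filter, sum_product, sum_pair hxst, sum_pair hxst, sum_pair hxst]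
      simp only [dist_self, dist_comm (x t) (x s)]
      by_cases h : dist (x s) (x t) = 1
      · simp [h]
      · simp [h]
    rw [hset, sum_pair hxst, hdeg, hdeg, hoc]
    linarith

end Summit.Ventures.Crystal3D.Theorems
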